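import Literature.Geometry.Lorentzian.OpensChartGeodesic
import Literature.Geometry.Lorentzian.CoordinateFrames
import Literature.Geometry.Lorentzian.GeodesicSpeed
import HarnessLib

/-!
# Covariant derivatives along curves in a chart, and the second fundamental form of a level set

Topic `Geometry/Riemannian` (chart calculus in the `OpensChart` setting of
`Literature.Geometry.Lorentzian.ChartCalculus`: a metric `g` on an open subset `U : Opens E` of a
finite-dimensional normed space with components `G : E → E →L E →L ℝ`, `g.val y = G y`).

* `covariantDerivAlong_eq_deriv_add_christoffel` — **the induced covariant derivative in the
  chart**: for a curve `γ` in `U` with coordinate expression `c` (`c' = ` its derivative at `t`)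
  and a field `W` along `γ` read as a map `W : ℝ → E` differentiable at `t`,
  `DW/dt (t) = W'(t) + Γ_{γ t}(W t)(c'(t))` (O'Neill 1983, Ch. 3, Prop. 18, the coordinate formula
  `Z' = ∑ (dZᵏ/dt + Γᵏᵢⱼ Zⁱ (xʲ∘α)') ∂ₖ` of its proof); the acceleration
  `D(γ')/dt = c'' + Γ(c', c')` (`covariantDerivAlong_velocity_eq`) is the case `W = c'`
  (O'Neill 1983, Ch. 3, Cor. 21).
* `val_covariantDerivAlong_normal_velocity` — **the second fundamental form of a level
  hypersurface through the Hessian, curve form** (Lee 2018, Problem 8-2 (a):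
  `h(X, Y) = -∇²F(X, Y)/|grad F|` for `N = grad F/|grad F|`, together with the Weingarten equation
  `⟨∇_X N, Y⟩ = -h(X, Y)`): if `c` runs in a level set of `F` (`F ∘ c` constant) and `N` is a
  field along `γ` which is `g`-orthogonal to `ker dF` at the points of `c`, with
  `dF(N 0) ≠ 0`, then
  `g(DN/dt(0), c'(0)) = (g(N 0, N 0)/dF(N 0)) · Hess F(c'(0), c'(0))`,
  `Hess F (X, X) = D²F(X, X) - DF(Γ(X, X))` the coordinate Hessian form
  (`OpensChart.hessianForm`, O'Neill 1983, Ch. 3, Lemma 49). Proof: `g(N, γ') ≡ 0` along `c`, so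
  `g(DN/dt, γ') = -g(N, Dγ'/dt) = -g(N, c'' + Γ(c', c'))`; `g(N 0, ·) = (g(N,N)/dF(N)) dF` since
  both sides vanish on `ker dF`; and `dF(c'') = -D²F(c', c')` by differentiating
  `dF_{c t}(c' t) = (F ∘ c)' = 0`.

This is the chart-level input for the lower bound `II ≥ -λ` on the boundary sphere of
Weinstein's disk (Weinstein 1968, proof of the main theorem, step (2): "`∂D` has second
fundamental form `> -λ`"), consumed in curve form by `ConeExitDerivative.lean`.

## References

* B. O'Neill, *Semi-Riemannian Geometry*, Academic Press (1983), Ch. 3, Prop. 18, Cor. 21,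
  Lemma 49. [cite: ONeill1983, Ch. 3, Prop. 3.18]
* J. M. Lee, *Introduction to Riemannian Manifolds*, 2nd ed., Springer GTM 176 (2018),
  Problem 8-2 (a). [cite: LeeRiemannianManifolds2018, Problem 8-2]
* A. Weinstein, Ann. of Math. (2) 87 (1968), 29–41. [cite: Weinstein1968]

Tags: [ChartCalculus] [SecondFundamentalForm] [LevelSet] [Weinstein1968]
-/

noncomputable section

open Bundle Set Filter Function TopologicalSpace
open scoped Manifold ContDiff Topology

namespace Literature.Geometry.Riemannian

open Literature.Geometry.Lorentzian
open Literature.Geometry.Lorentzian.OpensChart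
open Literature.Geometry.Lorentzian.PseudoRiemannianMetric

variable {E : Type*} [NormedAddCommGroup E] [NormedSpace ℝ E] [FiniteDimensional ℝ E]
  [CompleteSpace E] {U : Opens E} {n : ℕ∞ω} [Fact (1 ≤ n)]
  {g : PseudoRiemannianMetric 𝓘(ℝ, E) n E (TangentSpace 𝓘(ℝ, E) : U → Type _)}
  {G : E → E →L[ℝ] E →L[ℝ] ℝ}

/-! ### Curves in the chart: differentiability and the velocity -/

omit [FiniteDimensional ℝ E] [CompleteSpace E] [Fact (1 ≤ n)] in
/-- A curve in `U` whose coordinate expression has a derivative at `t` is differentiable at `t`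
(as a curve in the manifold `U`). [folklore] -/
theorem mdifferentiableAt_of_hasDerivAt_coe {γ : ℝ → U} {c : ℝ → E} {c' : E} {t : ℝ}
    (hγc : ∀ s, (γ s : E) = c s) (hc : HasDerivAt c c' t) :
    MDifferentiableAt 𝓘(ℝ, ℝ) 𝓘(ℝ, E) γ t := by
  set x₀ : U := γ t with hx₀_def
  set φ := extChartAt 𝓘(ℝ, E) x₀ with hφ_def
  have hγφ : ∀ s, γ s = φ.symm (c s) := fun s ↦ by
    apply Subtype.ext
    rw [hγc s, hφ_def, OpensChart.extChartAt_symm_val x₀ (by rw [← hγc s]; exact (γ s).2)]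
  have htgt : c t ∈ φ.target := by
    rw [hφ_def, OpensChart.extChartAt_target, ← hγc t]
    exact (γ t).2
  have h1 : MDifferentiableAt 𝓘(ℝ, E) 𝓘(ℝ, E) φ.symm (c t) :=
    (mdifferentiableWithinAt_extChartAt_symm htgt).mdifferentiableAt
      (by rw [ModelWithCorners.range_eq_univ]; exact univ_mem)
  have h2 : MDifferentiableAt 𝓘(ℝ, ℝ) 𝓘(ℝ, E) c t :=
    mdifferentiableAt_iff_differentiableAt.2 hc.differentiableAt
  have h3 := h1.comp t h2
  have h4 : (φ.symm ∘ c) = γ := funext fun s ↦ (hγφ s).symm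
  rwa [h4] at h3

omit [FiniteDimensional ℝ E] [CompleteSpace E] [Fact (1 ≤ n)] in
/-- **The velocity of a curve in the chart is the derivative of its coordinate expression.**
[folklore] -/
theorem velocity_eq_of_hasDerivAt_coe {γ : ℝ → U} {c : ℝ → E} {c' : E} {t : ℝ}
    (hγc : ∀ s, (γ s : E) = c s) (hc : HasDerivAt c c' t) :
    (velocity 𝓘(ℝ, E) γ t : E) = c' := by
  have hγd := mdifferentiableAt_of_hasDerivAt_coe hγc hc
  have hsrc : γ t ∈ (chartAt E (γ t)).source := by simp [OpensChart.chartAt_source]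
  have hφγ : (extChartAt 𝓘(ℝ, E) (γ t)) ∘ γ = c := funext fun s ↦ by
    simp only [Function.comp_apply, OpensChart.extChartAt_apply, hγc s]
  have h1 : HasDerivAt ((extChartAt 𝓘(ℝ, E) (γ t)) ∘ γ)
      (((trivializationAt E (TangentSpace 𝓘(ℝ, E)) (γ t)) ⟨γ t, velocity 𝓘(ℝ, E) γ t⟩).2) t :=
    hasDerivAt_extChartAt_comp hγd hsrc
  rw [hφγ, OpensChart.trivializationAt_apply] at h1
  exact h1.unique hc

/-! ### The induced covariant derivative in the chart -/

omit [CompleteSpace E] [Fact (1 ≤ n)] in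
/-- **`DW/dt = W' + Γ(W)(c')` in the chart `U`** (O'Neill 1983, Ch. 3, Prop. 18, coordinate
formula of the proof). Let `g` be a `C^n` metric on `U : Opens E` (`1 ≤ n`) with its Levi-Civita
connection and components `G` differentiable at every point; let `γ : ℝ → U` have coordinate
expression `c` with derivative `c'` at `t`, and let `W : ℝ → E`, read as a field along `γ`, have
derivative `W'` at `t`. Then `DW/dt (t) = W' + Γ_{γ t}(W t)(c')`, `Γ` the Christoffel map of the
components (`OpensChart.christoffel`, `∇_{X₀} Y₀ = Γ(Y₀)(X₀)` on constant fields): the frame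
formula `DW/dt = ∑ (Wⁱ)' bᵢ + ∑ Wⁱ ∇_{γ'} bᵢ` in the constant coordinate frame `bᵢ` of the chart
(`continuousLinearMapAt_covariantDerivAlong_sum_smul`, `OpensChart.leviCivita_const_apply`).
[cite: ONeill1983, Ch. 3, Prop. 3.18] -/
theorem covariantDerivAlong_eq_deriv_add_christoffel [g.HasLeviCivita]
    (hG : ∀ y : U, g.val y = G y) (hGd : ∀ y : U, DifferentiableAt ℝ G y)
    {γ : ℝ → U} {c : ℝ → E} {c' : E} {t : ℝ} (hγc : ∀ s, (γ s : E) = c s)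
    (hc : HasDerivAt c c' t) {W : ℝ → E} {W' : E} (hW : HasDerivAt W W' t) :
    (covariantDerivAlong g.leviCivita γ (fun s ↦ (W s : TangentSpace 𝓘(ℝ, E) (γ s))) t : E) =
      W' + christoffel g G (γ t) (W t) c' := by
  set x₀ : U := γ t with hx₀_def
  set b := Module.finBasis ℝ E with hb_def
  have hγd : MDifferentiableAt 𝓘(ℝ, ℝ) 𝓘(ℝ, E) γ t := mdifferentiableAt_of_hasDerivAt_coe hγc hc
  have hvel : (velocity 𝓘(ℝ, E) γ t : E) = c' := velocity_eq_of_hasDerivAt_coe hγc hc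
  -- the Christoffel data of the chart: `Ĉᵢ(y) w = ∇_w bᵢ = Γ_y(bᵢ)(w)`
  set Ĉ : Fin (Module.finrank ℝ E) → U → (E →L[ℝ] E) := fun i y ↦ christoffel g G y (b i)
    with hĈ_def
  have hN : (univ : Set U) ⊆ (chartAt E x₀).source := fun y _ ↦ by
    simp [OpensChart.chartAt_source]
  have hĈ : ∀ y ∈ (univ : Set U), ∀ (i) (w : TangentSpace 𝓘(ℝ, E) y),
      Ĉ i y ((trivializationAt E (TangentSpace 𝓘(ℝ, E)) x₀).continuousLinearMapAt ℝ y w) =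
        ((trivializationAt E (TangentSpace 𝓘(ℝ, E)) x₀)
          ⟨y, g.leviCivita ((trivializationAt E (TangentSpace 𝓘(ℝ, E)) x₀).localFrame b i)
            y w⟩).2 := by
    intro y _ i w
    rw [OpensChart.continuousLinearMapAt_trivializationAt_apply, OpensChart.trivializationAt_apply,
      localFrame_trivializationAt]
    exact (leviCivita_const_apply hG y (hGd y) (b i) w).symm
  -- the coefficients of `W` in the basis `b`
  set cc : Fin (Module.finrank ℝ E) → ℝ → ℝ := fun i s ↦ b.repr (W s) i with hcc_def
  have hccd : ∀ i, HasDerivAt (cc i) (b.repr W' i) t := fun i ↦ by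
    have h1 := ((b.coord i).toContinuousLinearMap.hasFDerivAt).comp_hasDerivAt t hW
    exact h1
  have hcc : ∀ i, DifferentiableAt ℝ (cc i) t := fun i ↦ (hccd i).differentiableAt
  -- the field `∑ ccⁱ bᵢ` is `W`
  have hfield : (fun s ↦ ∑ j, cc j s •
      (trivializationAt E (TangentSpace 𝓘(ℝ, E)) x₀).localFrame b j (γ s)) =
      fun s ↦ (W s : TangentSpace 𝓘(ℝ, E) (γ s)) := by
    funext s
    simp only [localFrame_trivializationAt, hcc_def]
    exact b.sum_repr (W s)
  have hA := continuousLinearMapAt_covariantDerivAlong_sum_smul (cov := g.leviCivita) b hN Ĉ hĈ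
    (mem_univ (γ t)) hγd hcc
  rw [hfield, OpensChart.continuousLinearMapAt_trivializationAt_apply,
    OpensChart.trivializationAt_apply] at hA
  rw [hA]
  -- identify the two sums
  have h1 : ∑ i, deriv (cc i) t • (b i : E) = W' := by
    have : ∀ i, deriv (cc i) t = b.repr W' i := fun i ↦ (hccd i).deriv
    simp only [this]
    exact b.sum_repr W'
  have h2 : ∑ i, cc i t • Ĉ i (γ t) c' = christoffel g G (γ t) (W t) c' := by
    simp only [hĈ_def, hcc_def]
    rw [← christoffel_sum, b.sum_repr]
  have hvel' : (show E from velocity 𝓘(ℝ, E) γ t) = c' := hvel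
  simp only [hvel']
  rw [h1, h2]

omit [CompleteSpace E] [Fact (1 ≤ n)] in
/-- **The acceleration in the chart: `D(γ')/dt = c'' + Γ(c')(c')`** (O'Neill 1983, Ch. 3,
Cor. 21): the case `W = c'` of `covariantDerivAlong_eq_deriv_add_christoffel`, the velocity field
of `γ` being `c'` (`velocity_eq_of_hasDerivAt_coe`). [cite: ONeill1983, Ch. 3, Cor. 21] -/
theorem covariantDerivAlong_velocity_eq [g.HasLeviCivita]
    (hG : ∀ y : U, g.val y = G y) (hGd : ∀ y : U, DifferentiableAt ℝ G y)
    {γ : ℝ → U} {c c' : ℝ → E} {c'' : E} {t : ℝ} (hγc : ∀ s, (γ s : E) = c s)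
    (hc : ∀ s, HasDerivAt c (c' s) s) (hc' : HasDerivAt c' c'' t) :
    (covariantDerivAlong g.leviCivita γ (fun s ↦ velocity 𝓘(ℝ, E) γ s) t : E) =
      c'' + christoffel g G (γ t) (c' t) (c' t) := by
  have hfield : (fun s ↦ velocity 𝓘(ℝ, E) γ s) = fun s ↦ (c' s : TangentSpace 𝓘(ℝ, E) (γ s)) :=
    funext fun s ↦ velocity_eq_of_hasDerivAt_coe hγc (hc s)
  rw [hfield]
  exact covariantDerivAlong_eq_deriv_add_christoffel hG hGd hγc (hc t) hc'

omit [CompleteSpace E] [Fact (1 ≤ n)] in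
/-- The lift `s ↦ (γ s, W s) ∈ TU` of a field read as a map `W : ℝ → E` differentiable at `t`,
along a curve differentiable at `t`, is differentiable at `t`. [folklore] -/
theorem mdifferentiableAt_lift_of_hasDerivAt {γ : ℝ → U} {c : ℝ → E} {c' : E} {t : ℝ}
    (hγc : ∀ s, (γ s : E) = c s) (hc : HasDerivAt c c' t) {W : ℝ → E} {W' : E}
    (hW : HasDerivAt W W' t) :
    MDifferentiableAt 𝓘(ℝ, ℝ) 𝓘(ℝ, E).tangent
      (fun s ↦ (TotalSpace.mk' E (γ s) (W s : TangentSpace 𝓘(ℝ, E) (γ s)) :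
        TangentBundle 𝓘(ℝ, E) U)) t := by
  set x₀ : U := γ t with hx₀_def
  set b := Module.finBasis ℝ E with hb_def
  have hγd : MDifferentiableAt 𝓘(ℝ, ℝ) 𝓘(ℝ, E) γ t := mdifferentiableAt_of_hasDerivAt_coe hγc hc
  set cc : Fin (Module.finrank ℝ E) → ℝ → ℝ := fun i s ↦ b.repr (W s) i with hcc_def
  have hcc : ∀ i, DifferentiableAt ℝ (cc i) t := fun i ↦
    (((b.coord i).toContinuousLinearMap.hasFDerivAt).comp_hasDerivAt t hW).differentiableAt
  have hfun : (fun s ↦ (TotalSpace.mk' E (γ s) (∑ j, cc j s •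
      (trivializationAt E (TangentSpace 𝓘(ℝ, E)) x₀).localFrame b j (γ s)) :
        TangentBundle 𝓘(ℝ, E) U)) =
      fun s ↦ (TotalSpace.mk' E (γ s) (W s : TangentSpace 𝓘(ℝ, E) (γ s)) :
        TangentBundle 𝓘(ℝ, E) U) := by
    funext s
    simp only [localFrame_trivializationAt, hcc_def]
    congr 1
    exact b.sum_repr (W s)
  have h := mdifferentiableAt_lift_sum_smul_localFrame (I := 𝓘(ℝ, E)) b
    (x₁ := x₀) (by simp [OpensChart.chartAt_source]) hγd hcc
  rw [hfun] at h
  exact h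

/-! ### The second fundamental form of a level set through the Hessian -/

omit [FiniteDimensional ℝ E] [CompleteSpace E] [Fact (1 ≤ n)] in
/-- Linear algebra: a functional `ℓ = G(N, ·)` vanishing on `ker φ`, with `φ N ≠ 0`, is the
multiple `(ℓ N / φ N) φ`. [folklore] -/
theorem apply_eq_div_mul_of_forall_ker {ℓ φ : E →L[ℝ] ℝ} {N : E}
    (hker : ∀ Z : E, φ Z = 0 → ℓ Z = 0) (hN : φ N ≠ 0) (Z : E) :
    ℓ Z = ℓ N / φ N * φ Z := by
  have h1 : φ (Z - (φ Z / φ N) • N) = 0 := by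
    rw [map_sub, map_smul, smul_eq_mul, div_mul_cancel₀ _ hN, sub_self]
  have h2 := hker _ h1
  rw [map_sub, map_smul, smul_eq_mul, sub_eq_zero] at h2
  rw [h2]
  ring

/-- **Second fundamental form of a level hypersurface, curve form** (Lee 2018, Problem 8-2 (a)
with the Weingarten equation). Let `g` be a `C^n` metric on `U : Opens E` (`1 ≤ n`) with its
Levi-Civita connection and differentiable components `G`; let `γ : ℝ → U` have a `C²` coordinate
expression `c` (`c'` its derivative, `c''` the derivative of `c'` at `0`) running in a level set
of a function `F` of class `C²` at `c 0` (`F ∘ c` constant); let `N : ℝ → E`, read as a field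
along `γ`, be differentiable at `0`, `g`-orthogonal to `ker dF_{c s}` at every `s`, with
`dF_{c 0}(N 0) ≠ 0`. Then
`g(DN/dt (0), c'(0)) = (g(N 0, N 0) / dF_{c 0}(N 0)) · Hess F_{γ 0}(c'(0), c'(0))` with the
coordinate Hessian form `Hess F(X, Y) = D²F(X, Y) - DF(Γ(Y)(X))` (`OpensChart.hessianForm`).
For the unit normal `N = grad F/|grad F|` the factor is `1/|dF|_g`, and the left side is
`⟨∇_X N, X⟩ = -h(X, X)` for `X = c'(0)`.
[cite: LeeRiemannianManifolds2018, Problem 8-2] [cite: ONeill1983, Ch. 3, Lemma 3.49] -/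
theorem val_covariantDerivAlong_normal_velocity [g.HasLeviCivita]
    (hG : ∀ y : U, g.val y = G y) (hGd : ∀ y : U, DifferentiableAt ℝ G y)
    {γ : ℝ → U} {c c' : ℝ → E} {c'' : E} (hγc : ∀ s, (γ s : E) = c s)
    (hc : ∀ s, HasDerivAt c (c' s) s) (hc' : HasDerivAt c' c'' 0)
    {F : E → ℝ} (hF : ContDiffAt ℝ 2 F (c 0)) (hlevel : ∀ s, F (c s) = F (c 0))
    {N : ℝ → E} {N' : E} (hN : HasDerivAt N N' 0)
    (hNperp : ∀ s, ∀ Z : E, fderiv ℝ F (c s) Z = 0 → G (c s) (N s) Z = 0)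
    (hm : fderiv ℝ F (c 0) (N 0) ≠ 0) :
    G (c 0) (covariantDerivAlong g.leviCivita γ (fun s ↦ (N s : TangentSpace 𝓘(ℝ, E) (γ s))) 0)
        (c' 0) =
      G (c 0) (N 0) (N 0) / fderiv ℝ F (c 0) (N 0) * hessianForm g G F (γ 0) (c' 0) (c' 0) := by
  have hLC := isLeviCivita_leviCivita_holds (g := g)
  have hcompat : g.IsCompatible g.leviCivita := hLC.2
  -- calculus of `F` near `c 0`
  have hF1 : DifferentiableAt ℝ F (c 0) := hF.differentiableAt (by norm_num)
  have hF2 : DifferentiableAt ℝ (fderiv ℝ F) (c 0) :=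
    (hF.fderiv_right (m := 1) le_rfl).differentiableAt one_ne_zero
  have hFev : ∀ᶠ z in 𝓝 (c 0), DifferentiableAt ℝ F z := by
    have h1 : ∀ᶠ z in 𝓝 (c 0), ContDiffAt ℝ 2 F z := hF.eventually (by simp)
    filter_upwards [h1] with z hz
    exact hz.differentiableAt (by norm_num)
  have hcev : ∀ᶠ s in 𝓝 (0 : ℝ), DifferentiableAt ℝ F (c s) :=
    (hc 0).continuousAt.eventually (by simpa using hFev)
  -- `dF_{c s}(c' s) = 0` near `0`: the derivative of the constant function `F ∘ c`
  have hker : ∀ᶠ s in 𝓝 (0 : ℝ), fderiv ℝ F (c s) (c' s) = 0 := by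
    filter_upwards [hcev] with s hs
    have h1 : HasDerivAt (fun s ↦ F (c s)) (fderiv ℝ F (c s) (c' s)) s :=
      hs.hasFDerivAt.comp_hasDerivAt s (hc s)
    have h2 : HasDerivAt (fun s ↦ F (c s)) 0 s := by
      have : (fun s ↦ F (c s)) = fun _ ↦ F (c 0) := funext hlevel
      rw [this]
      exact hasDerivAt_const s _
    exact h1.unique h2
  -- differentiating once more: `D²F(c', c') + DF(c'') = 0`
  have hsecond : fderiv ℝ (fderiv ℝ F) (c 0) (c' 0) (c' 0) + fderiv ℝ F (c 0) c'' = 0 := by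
    have h1 : HasDerivAt (fun s ↦ fderiv ℝ F (c s)) (fderiv ℝ (fderiv ℝ F) (c 0) (c' 0)) 0 :=
      hF2.hasFDerivAt.comp_hasDerivAt 0 (hc 0)
    have h2 : HasDerivAt (fun s ↦ fderiv ℝ F (c s) (c' s))
        (fderiv ℝ (fderiv ℝ F) (c 0) (c' 0) (c' 0) + fderiv ℝ F (c 0) c'') 0 :=
      h1.clm_apply hc'
    have h3 : HasDerivAt (fun s ↦ fderiv ℝ F (c s) (c' s)) 0 0 :=
      (hasDerivAt_const (0 : ℝ) (0 : ℝ)).congr_of_eventuallyEq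
        (hker.mono fun s hs ↦ hs)
    exact h2.unique h3
  -- `g(N, γ') ≡ 0` near `0`, hence `g(DN/dt, γ') + g(N, Dγ'/dt) = 0` at `0`
  have hvel : ∀ s, (velocity 𝓘(ℝ, E) γ s : E) = c' s :=
    fun s ↦ velocity_eq_of_hasDerivAt_coe hγc (hc s)
  have hNlift := mdifferentiableAt_lift_of_hasDerivAt hγc (hc 0) hN
  have hVlift : MDifferentiableAt 𝓘(ℝ, ℝ) 𝓘(ℝ, E).tangent
      (fun s ↦ (TotalSpace.mk' E (γ s) (velocity 𝓘(ℝ, E) γ s) : TangentBundle 𝓘(ℝ, E) U)) 0 := by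
    have h := mdifferentiableAt_lift_of_hasDerivAt hγc (hc 0) hc'
    have hfun : (fun s ↦ (TotalSpace.mk' E (γ s) (velocity 𝓘(ℝ, E) γ s) : TangentBundle 𝓘(ℝ, E) U))
        = fun s ↦ (TotalSpace.mk' E (γ s) (c' s : TangentSpace 𝓘(ℝ, E) (γ s)) :
          TangentBundle 𝓘(ℝ, E) U) := by
      funext s
      rw [← hvel s]
    rw [hfun]
    exact h
  have hder := g.hasDerivAt_val_apply_along hcompat hNlift hVlift
  have hzero : HasDerivAt (fun s ↦ g.val (γ s) (N s : TangentSpace 𝓘(ℝ, E) (γ s))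
      (velocity 𝓘(ℝ, E) γ s)) 0 0 := by
    refine (hasDerivAt_const (0 : ℝ) (0 : ℝ)).congr_of_eventuallyEq ?_
    filter_upwards [hker] with s hs
    rw [hG (γ s), hvel s]
    show G (γ s : E) (N s) (c' s) = 0
    rw [hγc s]
    exact hNperp s (c' s) hs
  have hsum := hder.unique hzero
  -- the acceleration in the chart
  have hacc := covariantDerivAlong_velocity_eq hG hGd hγc hc hc' (t := 0)
  -- `g(N 0, Z) = (g(N,N)/dF(N)) dF(Z)`
  have hprop : ∀ Z : E, G (c 0) (N 0) Z =
      G (c 0) (N 0) (N 0) / fderiv ℝ F (c 0) (N 0) * fderiv ℝ F (c 0) Z := fun Z ↦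
    apply_eq_div_mul_of_forall_ker (ℓ := G (c 0) (N 0)) (φ := fderiv ℝ F (c 0)) (hNperp 0) hm Z
  -- assemble
  have e1 : G (c 0) (covariantDerivAlong g.leviCivita γ
      (fun s ↦ (N s : TangentSpace 𝓘(ℝ, E) (γ s))) 0) (c' 0) =
      -(G (c 0) (N 0) (c'' + christoffel g G (γ 0) (c' 0) (c' 0))) := by
    have h1 : g.val (γ 0) (covariantDerivAlong g.leviCivita γ
        (fun s ↦ (N s : TangentSpace 𝓘(ℝ, E) (γ s))) 0) (velocity 𝓘(ℝ, E) γ 0) +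
        g.val (γ 0) (N 0 : TangentSpace 𝓘(ℝ, E) (γ 0))
          (covariantDerivAlong g.leviCivita γ (fun s ↦ velocity 𝓘(ℝ, E) γ s) 0) = 0 := hsum
    rw [hG (γ 0), hvel 0] at h1
    have h2 : G (γ 0 : E) (N 0) (covariantDerivAlong g.leviCivita γ
        (fun s ↦ velocity 𝓘(ℝ, E) γ s) 0) = G (γ 0 : E) (N 0) (c'' + christoffel g G (γ 0) (c' 0) (c' 0)) := by
      rw [← hacc]
    have h3 : G (c 0) = G (γ 0 : E) := by rw [hγc 0]
    rw [h3]
    have h1' : G (γ 0 : E) (covariantDerivAlong g.leviCivita γ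
        (fun s ↦ (N s : TangentSpace 𝓘(ℝ, E) (γ s))) 0) (c' 0) +
        G (γ 0 : E) (N 0) (covariantDerivAlong g.leviCivita γ (fun s ↦ velocity 𝓘(ℝ, E) γ s) 0)
          = 0 := h1
    rw [h2] at h1'
    linarith
  rw [e1, map_add, hprop c'', hprop (christoffel g G (γ 0) (c' 0) (c' 0)), hessianForm_apply]
  have h4 : ((γ 0 : U) : E) = c 0 := hγc 0
  rw [h4]
  have h5 : fderiv ℝ F (c 0) c'' = -(fderiv ℝ (fderiv ℝ F) (c 0) (c' 0) (c' 0)) := by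
    linarith
  rw [h5]
  ring

end Literature.Geometry.Riemannian

end
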